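import Literature.NumberTheory.EllipticCurves.Castella2018.ErratumHidaMembersFramesWeight
import HarnessLib

/-!
# Castella's erratum, proof of Thm. 1.1 (p. 4): the PUBLISHED member data with frames in the weight progression
# `k_m ≡ 2 (mod 2(p−1)p^{m−1})` — WITHOUT the (iii)-witness `q` (F3♯‡, «ram-free» member package)

Cell `bsd-stepL`, seat `bsd-stepL-imc-p1` g32 (K4 of `run/shared/lean/pub/bsd-stepL/imc-p1/g26/RAMFREE-REKEY-PROPOSAL.md`, §5).
ONE new named `Prop` (D-0014: +1 unproved; a CONJUNCTION of published results, each cited), obtained from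
`erratum_exists_frames_members_sigma_congruence_nonsplit_wt` (file `ErratumHidaMembersFramesWeight.lean`, F3♯†; all its
transcription notes and flags `MF-*` apply verbatim) by DELETING, and nothing else:

* the four binders of the (iii)-WITNESS — `(q : ℕ) [Fact q.Prime]`, `Mult W q →`,
  `((Ideal.span {(q : ℤ)}).primesOver (𝓞 K)).ncard ≠ 2 →`, `¬ p ∣ padicValInt q W.minimalDiscriminantInt →`;
* the two footnote-1 conjuncts of the member conclusion — `SkinnerUrban2014.IsResiduallyIrreducible D.Δ ∧` and
  `(∃ v, primesEquiv v = q ∧ SkinnerUrban2014.IsResiduallyRamifiedAt D.Δ v) ∧`.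

## Why this is the same print, and why the witness can go

The erratum's proof of Thm. 1.1 (p. 4) takes, for each `m ≥ 1`, a Hida-family member `g_m` of `f_E` with (a) weight
`k_m > 2`, `k_m ≡ 2 (mod p − 1)` (here in the sub-progression `2(p−1)p^{m−1} ∣ k_m − 2` on which the SELF-DUAL lattices are
congruent, exactly as in F3♯†), (b) `T_{g_m}/p^m ≃ T/p^m`, (c) `(L^Σ_p(g_m), p^m) = (L^Σ_p(f), p^m)` [Cas18 (4.1), Cas20 Thm. 2.11,
JSW17 §5.1], and the rigidity of automorphic types at the primes `ℓ ∣ M` non-split in `K` [FO12 L. 2.14] read on print's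
hypothesis (iii), first half («`E` has nonsplit multiplicative reduction at each prime `q ∥ N` which is nonsplit in `K`»,
KEPT here as a binder). NONE of these uses the second half of (iii) — the existence of a prime `q ∥ N` non-split in `K`
at which `E[p]` is RAMIFIED: Hida theory [Ski16 §2.6 (2-6-1), §3.1 (a)(b)] produces the members for every `p`-ordinary
`p`-stabilised newform (here `f_E`, `p ∥ N`, `a_p(E) = ±1`), the BDP∕Σ-imprimitive frames [Cas18 Thm. 3.1, Cas20 Thm. 2.11]
and the congruence (c) see only `(f, K, p, Σ)`. In the erratum the witness serves two other purposes, both OUTSIDE the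
member package: footnote 1 («`ρ̄_{g_m} ≃ E[p]` … irreducible and ramified at `q`») feeds hypothesis (i′) of the tree's
(ram)-specialised reading F4♯† of Thm. 2.3, and `q` itself is the prime of Thm. 2.3 (iii). On the tree, Thm. 2.3 is now
typed PRINT-FAITHFULLY as F4♯‡ (`erratumThm23_charIdeal_sigma_le_of_isTorsion_selfDual_irrK_OPEN`, hypotheses (i)
«`ρ̄_g|_{G_K}` irreducible» and (iii) «some `q ∥ M` non-split in `K`»), whose (i) at every member is a THEOREM from
`ρ̄_{E,p}` onto (`Summit.….Theorems.SurjIrrK.isSimpleOrder_subrepresentation_residualRep_comp_of_surj`, seat imc-p1 g27) and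
whose (iii) is the consumer's datum — so the member package no longer needs to carry the witness, and this `Prop` is the
member package AS PRINTED for every erratum-type datum `(E, p, K)`, in particular for the data of the «ram-free» road
(an odd non-split multiplicative `q ∥ N` ramified in `K` at which `E[p]` may be UNRAMIFIED, `ρ̄_{E,p}` onto by another
prime). Its conclusion is F3♯†'s conclusion minus two conjuncts; its hypotheses are F3♯†'s minus four binders; the two
`Prop`s are not comparable by implication (F3♯† asks more and gives more), and F3♯† is kept untouched.
STATUS: PUBLISHED inputs only ([Cas18 Thm. 3.1, (3.1), (4.1)], [Ski16 §2.6, §3.1], [Cas20 Thm. 2.11], [FO12 L. 2.14],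
[JSW17 §5.1]); no `p`-adic `L`-function is constructed here; nothing is asserted.

## References

* [Castella2018Erratum] F. Castella, Erratum to "On the `p`-part of the Birch–Swinnerton-Dyer formula for multiplicative
  primes", §2 (p. 2), proof of Thm. 1.1 (a)(b)(c) (p. 4).
* [Skinner2016PacificMC] C. Skinner, Multiplicative reduction and the cyclotomic main conjecture for GL₂, Pacific J. Math.
  283 (2016), §2.6 (2-6-1), §3.1 (a)(b) (p. 192).
* [Castella2020JIMJ] F. Castella, On the `p`-adic variation of Heegner points, JIMJ 19 (2020), Def. 2.10, Thm. 2.11, Rem. 2.12.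
* [Castella2018] F. Castella, On the `p`-part of the Birch–Swinnerton-Dyer formula for multiplicative primes, Camb. J. Math. 6
  (2018), Thm. 3.1, (3.1) (arXiv:1704.06608 p. 9), (4.1).
* [FouquetOchiai2012] O. Fouquet, T. Ochiai, Control theorems for Selmer groups of nearly ordinary deformations, Lem. 2.14.
* [JetchevSkinnerWan2017] D. Jetchev, C. Skinner, X. Wan, The BSD formula for elliptic curves of analytic rank one, §5.1.
-/

noncomputable section

open scoped Classical

open PowerSeries WeierstrassCurve NumberField IsDedekindDomain Field
  Literature.NumberTheory.EllipticCurves Literature.NumberTheory.EllipticCurves.ModularForms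
  Literature.NumberTheory.EllipticCurves.Rank1Residual Literature.NumberTheory.EllipticCurves.BigGaloisRep
  Literature.NumberTheory.EllipticCurves.GreenbergSelmer Literature.NumberTheory.GaloisRepresentations

namespace Literature.NumberTheory.EllipticCurves.Castella2018

/-- **Castella's erratum, proof of Thm. 1.1 — the PUBLISHED member data with frames, weight progression
`k_m ≡ 2 (mod 2(p−1)p^{m−1})`, WITHOUT the (iii)-witness (F3♯‡, «ram-free» member package).** For `E/ℚ` globally minimal of
conductor `N`, `p > 3` multiplicative, `M = N/p ≥ 3`, `E[p]` irreducible, `E` non-split multiplicative at every multiplicative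
prime non-split in `K` (print's (iii), first half), `K` imaginary quadratic of odd discriminant, Heegner for `N`, `p = 𝔭𝔭̄` split,
`𝔭` read through `ι`, `Γ` the anticyclotomic `ℤ_p`-extension, receptacle maps `a`, `j`: an `R₀`-frame `(Ω_K ≠ 0, Ω_p ∈ R₀ˣ, L)`
of `f` [Cas18 Thm. 3.1] and, for every `m ≥ 1`, a Hida member `D : HidaCongruentMember W p m` with `2(p−1)p^{m−1} ∣ k_m − 2`,
coefficient compatibility, the Steinberg sign `a_ℓ(g_m) = −ℓ^{k_m/2−1}` at every `ℓ ∣ M` non-split in `K` [FO12 L. 2.14], its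
Σ-imprimitive weight-`k_m` frame `Q_m` for the SAME periods [Cas20 Thm. 2.11, JSW17 §5.1], and the congruence (c)
`(Q_m, p^m) = (L·P_Σ, p^m)` in `𝓞_{ℂ_p}⟦T⟧` [Cas18 (3.1), (4.1)]. BYTE-IDENTICAL with
`erratum_exists_frames_members_sigma_congruence_nonsplit_wt` except that the four (iii)-witness binders and the two
footnote-1 conjuncts («`ρ̄_{g_m}` irreducible», «ramified at `q`») are deleted (see the module docstring: Hida theory, the
frames and (c) do not use the witness; (i) of Thm. 2.3 at the members is a theorem of the tree from `ρ̄_{E,p}` onto). A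
conjunction of published results (D-0014); nothing about `p`-adic `L`-functions is constructed here.
[cite: Castella2018Erratum, §2 (p. 2), Thm. 1.1 hypothesis (iii) first half, proof of Thm. 1.1 (a)(b)(c) (p. 4)]
[cite: Skinner2016PacificMC, §2.6 (2-6-1) and §3.1 (a)(b) (p. 192) (members at weights `k' ≡ 2 (mod p−1)` `p`-adically close to `2`)]
[cite: Castella2020JIMJ, Def. 2.10, Thm. 2.11 and Rem. 2.12] [cite: Castella2018, Thm. 3.1, (3.1) (p. 9), (4.1)]
[cite: FouquetOchiai2012, Lem. 2.14] [cite: JetchevSkinnerWan2017, §5.1] -/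
def erratum_exists_frames_members_sigma_congruence_wt_ramFree : Prop :=
  ∀ {p : ℕ} [Fact p.Prime] (ι : PadicAlgCl p ≃+* ℂ) (W : WeierstrassCurve ℚ) [W.IsElliptic]
    [W.IsGloballyMinimal] (K : Type) [Field K] [NumberField K]
    (𝔭 : HeightOneSpectrum (𝓞 K)) (κ : ZpExtension K p) (γ : absoluteGaloisGroup K)
    [Fact (κ.IsTopGenerator γ)] {N : ℕ} [NeZero N] {f : CuspForm (CongruenceSubgroup.Gamma0 N) 2}
    (_ : IsNewformOf W f),
    -- "`E/ℚ` … of conductor `N` with multiplicative reduction at `p > 3`", `M = N/p ≥ 3`, (i) `E[p]` irreducible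
    W.conductorNorm ℤ = N → 3 < p → Mult W p → 3 ≤ N / p → Irr W p →
    -- PRINT HYPOTHESIS (iii), first half, of the erratum's Thm. 1.1 (= arXiv:2409.01360 Thm. 1.3 / Thm. 3.1): "`E` has nonsplit
    -- multiplicative reduction at each prime `q ∥ N` which is nonsplit in `K`" — the printed source of the Steinberg-sign
    -- conjunct of the conclusion [FO12 L.2.14]; the second half (a witness `q` with `E[p]` ramified) is NOT a binder here
    (∀ (ℓ : ℕ) [Fact ℓ.Prime], Mult W ℓ → ((Ideal.span {(ℓ : ℤ)}).primesOver (𝓞 K)).ncard ≠ 2 →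
      ¬ W.HasSplitMultiplicativeReductionAtPrime ℓ) →
    -- `K` imaginary quadratic, `d_K` odd [Cas20 §2.5], Heegner for `N`, `p = 𝔭𝔭̄` split, `𝔭` via `ι`
    IsImaginaryQuadratic K → Odd (NumberField.discr K) → (∃ β : ℤ, (4 * N : ℤ) ∣ β ^ 2 - NumberField.discr K) →
    ((Ideal.span {(p : ℤ)}).primesOver (𝓞 K)).ncard = 2 →
    ((p : ℕ) : 𝓞 K) ∈ 𝔭.asIdeal →
    (∀ (w : InfinitePlace K) (x : 𝓞 K), x ∈ 𝔭.asIdeal ↔ ‖ι.symm (w.embedding (x : K))‖ < 1) →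
    -- `Γ` THE anticyclotomic `ℤ_p`-extension
    κ.IsAnticyclotomic →
    -- receptacle maps: `a : R₀ ⊆ 𝓞_{ℂ_p}` the inclusion, `j : ℤ_p → R₀` the structure map (characterised)
    ∀ (a : unrIntegers p →+* PadicComplexInt p) (j : ℤ_[p] →+* unrIntegers p),
      (∀ x : unrIntegers p, ((a x : PadicComplexInt p) : ℂ_[p]) = (x : ℂ_[p])) →
      (∀ x : ℤ_[p], ((j x : unrIntegers p) : ℂ_[p]) = algebraMap ℚ_[p] ℂ_[p] (x : ℚ_[p])) →
    -- THEN: an `R₀`-frame of `f` at `(ι, 𝔭)` [Cas18 Thm. 3.1] …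
    ∃ (ΩK : ℂ) (Ωp : (unrIntegers p)ˣ) (L : UnrSeries p),
      ΩK ≠ 0 ∧ IsBDPLFunction ι 𝔭 κ γ f ΩK ((Ωp : unrIntegers p) : ℂ_[p]) L ∧
      -- … and for every `m ≥ 1` a member (a)+(b) with its printed properties and its Σ-imprimitive `p`-adic `L`-function
      ∀ m : ℕ, 1 ≤ m →
        ∃ (D : Skinner2016.HidaCongruentMember W p m) (Qm : PowerSeries (PadicComplexInt p)),
          -- the member's weight lies in the progression `k_m ≡ 2 (mod 2(p−1)p^{m−1})`
          (2 * ((p : ℤ) - 1) * (p : ℤ) ^ (m - 1)) ∣ D.k - 2 ∧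
          -- the member's `p`-adic coefficient embedding IS the fixed `ı_p = ι⁻¹` on `ℚ(g_m) ⊂ ℂ` (flag `MF-compat`)
          (∀ x : coeffField D.g, ι (D.ι x) = (x : ℂ)) ∧
          -- rigidity of automorphic types [FO12 L.2.14]: `π(g_m)_ℓ` special ⊗ (`ℓ ↦ −ℓ^{k_m/2−1}`) at every `ℓ ∣ M` non-split in `K`
          (∀ ℓ : ℕ, ℓ.Prime → ℓ ∣ N / p → ((Ideal.span {(ℓ : ℤ)}).primesOver (𝓞 K)).ncard ≠ 2 →
            (UpperHalfPlane.qExpansion 1 ⇑D.g).coeff ℓ = -((ℓ : ℂ) ^ (D.k / 2 - 1).toNat)) ∧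
          -- `Q_m = L^Σ_p(g_m)`: the Σ-imprimitive frame of `g_m` for the SAME periods [Cas20 Thm. 2.11, JSW17 §5.1]
          IsBDPLFunctionWtSigmaInt ι 𝔭 κ γ D.g (W.sigmaPlacesFinset p K) ΩK ((Ωp : unrIntegers p) : ℂ_[p]) Qm ∧
          -- (c): `(L^Σ_p(g_m), p^m) = (L^Σ_p(f), p^m)`, `L^Σ_p(f) = L_p(f)·P_Σ` [Cas18 (3.1)], read in `𝓞_{ℂ_p}⟦T⟧`
          Ideal.span {Qm} ⊔ Ideal.span {(PowerSeries.C (((p : ℕ) : PadicComplexInt p) ^ m))} =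
            Ideal.span {PowerSeries.map a (L * PowerSeries.map j (W.sigmaEulerElement p K κ))} ⊔
              Ideal.span {(PowerSeries.C (((p : ℕ) : PadicComplexInt p) ^ m))}

end Literature.NumberTheory.EllipticCurves.Castella2018

end
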